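import Literature.NumberTheory.ConnesConsani2021.SchwartzKernels
import Literature.NumberTheory.ConnesConsani2021.CosineTail
import HarnessLib

/-!
# Connes–Consani 2021, Prop. 2.2: the square-`Δ` half (L2) of the cosine-tail energy identity

A. Connes, C. Consani, *Weil positivity and trace formula, the archimedean place*, Selecta Math.
(N.S.) 27 (2021) 77 = arXiv:2006.13771 [bib: `ConnesConsani2021`], §2 Prop. 2.2 (= arXiv Prop. 10),
p. 10.

LABEL: RH-FREE corpus analysis (Fubini and changes of variables on compact boxes).
bears_on: W-C/W-P, K1 boundary fact `CC2021_prop_2_2_iii` (route item stmt-RiemannHypothesis-19305) —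
its discharge programme `CC2021_prop_2_2_iii_of_cosTail_energy T1 T2` (`CutoffScalingKernelEnergy.lean`)
needs the energy identity (T2) `4 ∫_{s ≥ 0}∫_ℝ ‖cosTail g s c‖² = Re L(g ⋆ g̃)`, `L = archW + remainderD`,
which the frame leaf `CosineTailEnergy.lean` splits into a `W_∞`/log-moment half (L1) and the present
square-`Δ` half (L2).
WHAT THIS IS NOT: any claim about RH — an identity between absolutely convergent real integrals attached
to the archimedean trace remainder `δ`; nothing here bears on the truth of RH.

## The statement (`cosTail_deltaSquare`)

For a Weil test function `g` with `tsupport g ⊆ [−a, a]`: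

`4·(∫_{c ≤ a} (a − c)‖cosTailFull g c‖² dc) − 4·(∫_{m ∈ [−a,a]} ∫_{c ≤ m} ‖cosTail g (c − m) c‖² dc dm)
   = Re remainderD (weilConv g (weilReflect g))`,

with `cosTail g s c = ∫_{v ≥ s} g(v − c) e^{v/2}cos(2πe^v) dv`, `cosTailFull g c` = the same over `ℝ`
(`CosineTail.lean`), `remainderD k = ∫ k(t) δ(e^t) dt`, `δ = traceRemainder` (`SchwartzKernels.lean`).

## The proof (additive variables throughout; the printed ingredients are Prop. 2.2 (i)–(ii))

With `u = v − c` both transforms are `u`-integrals of `G_c(u) := g(u) e^{(u+c)/2} cos(2π e^{u+c})`, the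
full one over `ℝ`, the cut one (`s = c − m`) over `u ≥ −m`.  Then

1. `‖∫_ℝ G_c‖² − ‖∫_{u ≥ −m} G_c‖² = ∫∫ 1_{¬(u ≥ −m ∧ u' ≥ −m)} G_c(u) conj G_c(u') du du'`
   (`mul_conj_integral_sub_mul_conj_setIntegral`);
2. the resulting integrand on `{(m,c) : c ≤ m ≤ a} × ℝ²` is dominated by `M²e^a·1_{c≤m≤a}e^c·1_{[−a,a]²}`,
   hence integrable on `ℝ² × ℝ²` (`integrable_deltaSquare_kernel4`) and Fubini swaps `(m,c) ↔ (u,u')`;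
3. for fixed `(u,u')` in the support, `1_{m ≤ a}1_{¬(…)} = 1_{m < −min(u,u')}` and three substitutions
   (`w = e^c`, `w = Wy`, `W = e^m = e^{−min}s`) evaluate the `(m,c)`-integral as
   `e^{−min(u,u')}·Δ(e^{|u−u'|})`, `Δ = deltaSquareIntegral` VERBATIM the tree's square-`Δ` integral
   (`kernel_eq_deltaSquareIntegral`); with the prefactor `4e^{(u+u')/2} = 4ρ^{1/2}e^{−… }` this is
   `δ(e^{|u−u'|}) = δ(e^{u−u'})` by Prop. 2.2 (i) — the DISCHARGED fact `CC2021_prop_2_2_i_holds` — and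
   Prop. 2.2 (ii) `traceRemainder_inv` (`four_mul_exp_mul_kernel_eq_traceRemainder`);
4. `∫∫ g(u) conj g(u') δ(e^{u−u'}) du' du = ∫ (g ⋆ g̃)(t) δ(e^t) dt = remainderD (weilConv g (weilReflect g))`
   by `u' = u − t` and `weilConv_apply` (`integral_integral_mul_conj_mul_traceRemainder_eq_remainderD`);
5. finally the real bookkeeping: `(a − c) = ∫ 1_{c ≤ m ≤ a} dm` and `∫_{m ∈ [−a,a]} = ∫_{m ≤ a}` (the cut
   transform vanishes for `m < −a`, `cosTail_eq_zero`) by Fubini on the wedge `{c ≤ m ≤ a}` with the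
   dominators `norm_cosTailFull_le` / `norm_cosTail_le` of `CosineTail.lean`.

Theorems only (helpers in the sub-namespace `CosTailDeltaSquare`, the uncited plumbing `private`); no
definitions, no named facts.
Cell record: rh-crit cc board 2026-08-26 — R94 (2) (deal), t1 g2 09:52:51Z (target signature and the
shared definitions `CosineTail.lean`), gm-t13 g2 10:09:26Z (consumer shape), t18 g2 (this file).

## References
* A. Connes, C. Consani, arXiv:2006.13771 = Selecta Math. 27 (2021) 77, §2 Def. 2.1, Prop. 2.2 (i)–(iii)
  (= arXiv Def. 9, Prop. 10) p. 10; §1 Lemma 1.4 (i) eq. (16) p. 7. [ConnesConsani2021]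
-/

open MeasureTheory Set Real Complex
open scoped ComplexConjugate

namespace Literature.NumberTheory.ConnesConsani2021

open Literature.NumberTheory.LFunctions

namespace CosTailDeltaSquare

/-! ## 1. Three changes of variables -/

/-- Change of variables `w = e^c` on `(-∞, m]`: `∫_{c ≤ m} e^c·h(e^c) dc = ∫_{(0, e^m]} h(w) dw`
(`MeasureTheory.integral_image_eq_integral_abs_deriv_smul` for `exp` and `Real.image_exp_Iic`; no
integrability hypothesis is needed). [folklore] -/
private theorem setIntegral_Iic_exp_mul_comp_exp (h : ℝ → ℝ) (m : ℝ) :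
    ∫ c in Iic m, rexp c * h (rexp c) = ∫ w in Ioc 0 (rexp m), h w := by
  have himage : Real.exp '' Iic m = Ioc 0 (rexp m) := Real.image_exp_Iic m
  have hderiv : ∀ c ∈ Iic m, HasDerivWithinAt Real.exp (rexp c) (Iic m) c :=
    fun c _ => (Real.hasDerivAt_exp c).hasDerivWithinAt
  have hcv := integral_image_eq_integral_abs_deriv_smul measurableSet_Iic hderiv
    Real.exp_injective.injOn h
  rw [himage] at hcv
  rw [hcv]
  refine setIntegral_congr_fun measurableSet_Iic (fun c _ => ?_)
  rw [abs_of_pos (Real.exp_pos c), smul_eq_mul]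

/-- Change of variables `W = e^m` on `(-∞, m₀)`: `∫_{m < m₀} Φ(e^m) dm = ∫_{(0, e^{m₀})} Φ(W)/W dW`. [folklore] -/
private theorem setIntegral_Iio_comp_exp (Φ : ℝ → ℝ) (m₀ : ℝ) :
    ∫ m in Iio m₀, Φ (rexp m) = ∫ W in Ioo 0 (rexp m₀), Φ W / W := by
  have himage : Real.exp '' Iio m₀ = Ioo 0 (rexp m₀) := Real.image_exp_Iio m₀
  have hderiv : ∀ c ∈ Iio m₀, HasDerivWithinAt Real.exp (rexp c) (Iio m₀) c :=
    fun c _ => (Real.hasDerivAt_exp c).hasDerivWithinAt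
  have hcv := integral_image_eq_integral_abs_deriv_smul measurableSet_Iio hderiv
    Real.exp_injective.injOn (fun W => Φ W / W)
  rw [himage] at hcv
  rw [hcv]
  refine setIntegral_congr_fun measurableSet_Iio (fun c _ => ?_)
  rw [abs_of_pos (Real.exp_pos c), smul_eq_mul, mul_div_cancel₀ _ (Real.exp_pos c).ne']

/-- Scaling `w = W·y` on `(0, W]` for `W > 0`: `∫_{(0, W]} h(w) dw = W·∫_{(0, 1]} h(W y) dy`. [folklore] -/
private theorem setIntegral_Ioc_eq_mul_setIntegral_comp_mul (h : ℝ → ℝ) {W : ℝ} (hW : 0 < W) :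
    ∫ w in Ioc 0 W, h w = W * ∫ y in Ioc 0 1, h (W * y) := by
  rw [← intervalIntegral.integral_of_le hW.le, ← intervalIntegral.integral_of_le zero_le_one,
    ← smul_eq_mul, intervalIntegral.smul_integral_comp_mul_left h W, mul_zero, mul_one]

/-! ## 2. The square-`Δ` kernel in additive variables (Prop. 2.2 (i)–(ii)) -/

/-- **The square-`Δ` kernel in additive variables.**  For `u, u' ∈ ℝ`,
`∫_{m < −min(u,u')} ∫_{c ≤ m} e^c cos(2π e^{u+c}) cos(2π e^{u'+c}) dc dm = e^{−min(u,u')}·Δ(e^{|u−u'|})`, where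
`Δ(ρ) = deltaSquareIntegral ρ = ∫∫_{(0,1]²} cos(2πρxy) cos(2πxy)` is the square-`Δ` double integral of
Prop. 2.2 (i): for `u' ≤ u` the substitutions `w = e^c` (`(−∞, m] → (0, e^m]`), `w = W y`, `W = e^m`
(`(−∞, −u') → (0, e^{−u'})`) and `W = e^{−u'} s` map the region `{c ≤ m < −u'}` onto the unit square with
the Jacobian `e^{−u'}` and the frequency ratio `ρ = e^{u−u'}`; the case `u ≤ u'` by symmetry.
[cite: ConnesConsani2021, §2 Prop. 2.2 (i) (= arXiv Prop. 10 (i)) eq. (23) p. 10 (chunk p0010:L15–L18; proof L25–L49)] -/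
theorem kernel_eq_deltaSquareIntegral (u u' : ℝ) :
    ∫ m in Iio (-min u u'), ∫ c in Iic m,
        rexp c * (Real.cos (2 * π * rexp (u + c)) * Real.cos (2 * π * rexp (u' + c))) =
      rexp (-min u u') * deltaSquareIntegral (rexp |u - u'|) := by
  wlog hle : u' ≤ u generalizing u u' with H
  · have h := H u' u (le_of_not_ge hle)
    rw [min_comm, abs_sub_comm] at h
    rw [← h]
    refine setIntegral_congr_fun measurableSet_Iio (fun m _ => ?_)
    refine setIntegral_congr_fun measurableSet_Iic (fun c _ => ?_)
    rw [mul_comm (Real.cos _)]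
  -- main case `u' ≤ u`
  have hmin : min u u' = u' := min_eq_right hle
  have habs : |u - u'| = u - u' := abs_of_nonneg (sub_nonneg.2 hle)
  rw [hmin, habs]
  set h : ℝ → ℝ := fun w => Real.cos (2 * π * (rexp u * w)) * Real.cos (2 * π * (rexp u' * w)) with hh
  -- step 1: inner substitution `w = e^c`
  have step1 : ∀ m : ℝ, ∫ c in Iic m,
      rexp c * (Real.cos (2 * π * rexp (u + c)) * Real.cos (2 * π * rexp (u' + c))) =
      ∫ w in Ioc 0 (rexp m), h w := by
    intro m
    rw [← setIntegral_Iic_exp_mul_comp_exp h m]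
    refine setIntegral_congr_fun measurableSet_Iic (fun c _ => ?_)
    simp only [hh, Real.exp_add]
  simp_rw [step1]
  -- step 2: outer substitution `W = e^m`
  rw [setIntegral_Iio_comp_exp (fun W => ∫ w in Ioc 0 W, h w) (-u')]
  -- step 3: `Φ(W)/W = ∫_0^1 h(W y) dy` on `(0, W₀)`, then `Ioo → Ioc`
  have step3 : ∫ W in Ioo 0 (rexp (-u')), (∫ w in Ioc 0 W, h w) / W =
      ∫ W in Ioc 0 (rexp (-u')), ∫ y in Ioc (0:ℝ) 1, h (W * y) := by
    rw [setIntegral_congr_set (Ioo_ae_eq_Ioc (μ := (volume : Measure ℝ)))]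
    refine setIntegral_congr_fun measurableSet_Ioc (fun W hW => ?_)
    rw [setIntegral_Ioc_eq_mul_setIntegral_comp_mul h hW.1, mul_div_cancel_left₀ _ hW.1.ne']
  rw [step3]
  -- step 4: scaling `W = W₀ s`
  rw [setIntegral_Ioc_eq_mul_setIntegral_comp_mul (fun W => ∫ y in Ioc (0:ℝ) 1, h (W * y))
    (Real.exp_pos (-u'))]
  -- step 5: identify with `deltaSquareIntegral`
  congr 1
  rw [deltaSquareIntegral]
  refine setIntegral_congr_fun measurableSet_Ioc (fun s _ => ?_)
  refine setIntegral_congr_fun measurableSet_Ioc (fun y _ => ?_)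
  simp only [hh]
  have e1 : rexp u * (rexp (-u') * s * y) = rexp (u - u') * s * y := by
    rw [Real.exp_sub, Real.exp_neg]; ring
  have e2 : rexp u' * (rexp (-u') * s * y) = s * y := by
    rw [Real.exp_neg, ← mul_assoc, ← mul_assoc, mul_inv_cancel₀ (Real.exp_pos u').ne', one_mul]
  rw [e1, e2]
  congr 2 <;> ring

/-- `4 e^{(u+u')/2} · (square-Δ kernel)(u, u') = δ(e^{u−u'})`, `δ = traceRemainder`: by
`kernel_eq_deltaSquareIntegral`, Prop. 2.2 (i) `δ(ρ) = 4ρ^{1/2}Δ(ρ)` for `ρ = e^{|u−u'|} ≥ 1` (the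
DISCHARGED fact, `CC2021_prop_2_2_i_holds`) and the symmetry `δ(ρ⁻¹) = δ(ρ)` of Prop. 2.2 (ii)
(`traceRemainder_inv`).
[cite: ConnesConsani2021, §2 Prop. 2.2 (i)–(ii) (= arXiv Prop. 10 (i)–(ii)) p. 10 (chunk p0010:L15–L19)] -/
theorem four_mul_exp_mul_kernel_eq_traceRemainder (u u' : ℝ) :
    4 * rexp ((u + u') / 2) * ∫ m in Iio (-min u u'), ∫ c in Iic m,
        rexp c * (Real.cos (2 * π * rexp (u + c)) * Real.cos (2 * π * rexp (u' + c))) =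
      traceRemainder (rexp (u - u')) := by
  rw [kernel_eq_deltaSquareIntegral]
  have hρ : 1 ≤ rexp |u - u'| := Real.one_le_exp (abs_nonneg _)
  have hsqrt : Real.sqrt (rexp |u - u'|) = rexp (|u - u'| / 2) := by
    rw [Real.sqrt_eq_iff_mul_self_eq_of_pos (Real.exp_pos _), ← Real.exp_add, add_halves]
  have hexp : rexp ((u + u') / 2) * rexp (-min u u') = rexp (|u - u'| / 2) := by
    rw [← Real.exp_add]
    congr 1
    rcases le_total u u' with h | h
    · rw [min_eq_left h, abs_of_nonpos (sub_nonpos.2 h)]; ring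
    · rw [min_eq_right h, abs_of_nonneg (sub_nonneg.2 h)]; ring
  have key : traceRemainder (rexp |u - u'|) =
      4 * Real.sqrt (rexp |u - u'|) * deltaSquareIntegral (rexp |u - u'|) :=
    CC2021_prop_2_2_i_holds _ hρ
  have hsymm : traceRemainder (rexp (u - u')) = traceRemainder (rexp |u - u'|) := by
    rcases le_total u u' with h | h
    · rw [abs_of_nonpos (sub_nonpos.2 h), Real.exp_neg, traceRemainder_inv]
    · rw [abs_of_nonneg (sub_nonneg.2 h)]
  rw [hsymm, key, hsqrt, ← hexp]
  ring

/-! ## 3. The outer assembly `∫∫ g ḡ δ = D(g ⋆ g̃)` -/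

/-- **Outer assembly.**  For continuous `g` vanishing off `[−a, a]`,
`∫∫ g(u) conj(g(u')) δ(e^{u−u'}) du' du = D(g ⋆ g̃)`, where `D k = remainderD k = ∫ k(t) δ(e^t) dt` and
`(g ⋆ g̃)(t) = weilConv g (weilReflect g) t = ∫ g(u) conj(g(u − t)) du` (`weilConv_apply`,
`weilReflect g x = conj (g (−x))`): substitute `u' = u − t` and swap the two integrals (continuous
integrand with compact support in `(u, t)`).
[cite: ConnesConsani2021, §2 Def. 2.1 (= arXiv Def. 9) p. 10 (chunk p0010:L7); Prop. 2.2 (iii) (= arXiv Prop. 10 (iii)) right-hand side p. 10 (chunk p0010:L20–L23)] -/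
theorem integral_integral_mul_conj_mul_traceRemainder_eq_remainderD {g : ℝ → ℂ} (hg : Continuous g)
    {a : ℝ} (hsupp : ∀ u, a < |u| → g u = 0) :
    ∫ u, ∫ u', g u * conj (g u') * (traceRemainder (rexp (u - u')) : ℂ) =
      remainderD (weilConv g (weilReflect g)) := by
  -- substitute `u' = u - t` in the inner integral
  have h1 : ∀ u : ℝ, ∫ u', g u * conj (g u') * (traceRemainder (rexp (u - u')) : ℂ) =
      ∫ t, g u * conj (g (u - t)) * (traceRemainder (rexp t) : ℂ) := by
    intro u
    rw [← integral_sub_left_eq_self (fun u' => g u * conj (g u') * (traceRemainder (rexp (u - u')) : ℂ)) volume u]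
    refine integral_congr_ae (Filter.Eventually.of_forall fun t => ?_)
    simp only [sub_sub_cancel]
  simp_rw [h1]
  -- Fubini: the integrand is continuous with compact support in `(u, t)`
  have hδ : Continuous fun t : ℝ => (traceRemainder (rexp t) : ℂ) :=
    continuous_ofReal.comp continuous_traceRemainder_exp
  have hcont : Continuous (Function.uncurry fun u t : ℝ =>
      g u * conj (g (u - t)) * (traceRemainder (rexp t) : ℂ)) := by
    refine ((hg.comp continuous_fst).mul ?_).mul (hδ.comp continuous_snd)
    exact (continuous_conj.comp (hg.comp (continuous_fst.sub continuous_snd)))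
  have hK : IsCompact (Icc (-|a|) (|a|) ×ˢ Icc (-(2 * |a|)) (2 * |a|)) :=
    isCompact_Icc.prod isCompact_Icc
  have hsupp2 : HasCompactSupport (Function.uncurry fun u t : ℝ =>
      g u * conj (g (u - t)) * (traceRemainder (rexp t) : ℂ)) := by
    refine HasCompactSupport.intro hK ?_
    rintro ⟨u, t⟩ hut
    simp only [Function.uncurry_apply_pair]
    simp only [mem_prod, mem_Icc, not_and_or, not_le] at hut
    have hga : ∀ v, g v ≠ 0 → |v| ≤ |a| := by
      intro v hv
      by_contra h
      exact hv (hsupp v (lt_of_le_of_lt (le_abs_self a) (not_le.1 h)))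
    by_cases hu : g u = 0
    · rw [hu, zero_mul, zero_mul]
    by_cases hut' : g (u - t) = 0
    · rw [hut', map_zero, mul_zero, zero_mul]
    exfalso
    have h1 := hga u hu
    have h2 := hga (u - t) hut'
    rw [abs_le] at h1 h2
    rcases hut with (h | h) | (h | h) <;> linarith
  have hint : Integrable (Function.uncurry fun u t : ℝ =>
      g u * conj (g (u - t)) * (traceRemainder (rexp t) : ℂ)) (volume.prod volume) :=
    hcont.integrable_of_hasCompactSupport hsupp2
  rw [integral_integral_swap hint]
  -- identify with `remainderD`
  rw [remainderD]
  refine integral_congr_ae (Filter.Eventually.of_forall fun t => ?_)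
  simp only
  rw [weilConv_apply, ← integral_mul_const]
  refine integral_congr_ae (Filter.Eventually.of_forall fun u => ?_)
  simp only [weilReflect, neg_sub]

/-! ## 4. Expanding the squares; the Fubini licence on `ℝ² × ℝ²` -/

/-- Complex conjugation preserves integrability (`Complex.conjCLE`). [folklore] -/
private theorem integrable_conj_of_integrable {X : Type*} [MeasurableSpace X] {μ : Measure X} {A : X → ℂ}
    (hA : Integrable A μ) : Integrable (fun x => conj (A x)) μ := by
  simpa using Complex.conjCLE.toContinuousLinearMap.integrable_comp hA

/-- **Expanding the two squares.**  For an integrable `A : ℝ → ℂ` and a measurable set `S`,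
`(∫A)·conj(∫A) − (∫_S A)·conj(∫_S A) = ∫_{ℝ²} 1_{(S×S)ᶜ}(p) A(p.1)·conj A(p.2) dp` (`integral_prod_mul` twice). [folklore] -/
private theorem mul_conj_integral_sub_mul_conj_setIntegral {A : ℝ → ℂ} (hA : Integrable A) {S : Set ℝ}
    (hS : MeasurableSet S) :
    (∫ u, A u) * conj (∫ u, A u) - (∫ u in S, A u) * conj (∫ u in S, A u) =
      ∫ p : ℝ × ℝ, (S ×ˢ S)ᶜ.indicator (fun p => A p.1 * conj (A p.2)) p ∂(volume.prod volume) := by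
  have hB : Integrable (S.indicator A) := hA.indicator hS
  have e1 : (∫ u, A u) * conj (∫ u, A u) = ∫ p : ℝ × ℝ, A p.1 * conj (A p.2) ∂(volume.prod volume) := by
    rw [← integral_conj, ← integral_prod_mul]
  have e2 : (∫ u in S, A u) * conj (∫ u in S, A u) =
      ∫ p : ℝ × ℝ, S.indicator A p.1 * conj (S.indicator A p.2) ∂(volume.prod volume) := by
    rw [← integral_indicator hS, ← integral_conj, ← integral_prod_mul]
  rw [e1, e2, ← integral_sub (hA.mul_prod (integrable_conj_of_integrable hA))
    (hB.mul_prod (integrable_conj_of_integrable hB))]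
  refine integral_congr_ae (Filter.Eventually.of_forall fun p => ?_)
  by_cases h1 : p.1 ∈ S <;> by_cases h2 : p.2 ∈ S
  · have hp : p ∉ (S ×ˢ S)ᶜ := fun h => h ⟨h1, h2⟩
    simp [indicator_of_mem, indicator_of_notMem, h1, h2, hp]
  · have hp : p ∈ (S ×ˢ S)ᶜ := fun h => h2 h.2
    simp [indicator_of_mem, indicator_of_notMem, h1, h2, hp]
  · have hp : p ∈ (S ×ˢ S)ᶜ := fun h => h1 h.1
    simp [indicator_of_mem, indicator_of_notMem, h1, h2, hp]
  · have hp : p ∈ (S ×ˢ S)ᶜ := fun h => h1 h.1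
    simp [indicator_of_mem, indicator_of_notMem, h1, h2, hp]

/-- The dominating function `1_{c ≤ m ≤ a}·e^c` is integrable on `ℝ²` (coordinates `q = (m, c)`; its
total mass is `∫_{m ≤ a} e^m dm = e^a`). [folklore] -/
private theorem integrable_indicator_wedge_exp (a : ℝ) :
    Integrable ({q : ℝ × ℝ | q.2 ≤ q.1 ∧ q.1 ≤ a}.indicator fun q => rexp q.2) (volume.prod volume) := by
  have hT : MeasurableSet {q : ℝ × ℝ | q.2 ≤ q.1 ∧ q.1 ≤ a} :=
    (measurableSet_le measurable_snd measurable_fst).inter (measurableSet_le measurable_fst measurable_const)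
  have hmeas : AEStronglyMeasurable ({q : ℝ × ℝ | q.2 ≤ q.1 ∧ q.1 ≤ a}.indicator fun q => rexp q.2)
      (volume.prod volume) :=
    ((Real.measurable_exp.comp measurable_snd).indicator hT).aestronglyMeasurable
  rw [integrable_prod_iff hmeas]
  constructor
  · refine Filter.Eventually.of_forall fun m => ?_
    by_cases hm : m ≤ a
    · have : (fun c : ℝ => {q : ℝ × ℝ | q.2 ≤ q.1 ∧ q.1 ≤ a}.indicator (fun q => rexp q.2) (m, c)) =
          (Iic m).indicator rexp := by
        funext c
        by_cases hc : c ≤ m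
        · rw [indicator_of_mem (show (m, c) ∈ {q : ℝ × ℝ | q.2 ≤ q.1 ∧ q.1 ≤ a} from ⟨hc, hm⟩),
            indicator_of_mem (mem_Iic.2 hc)]
        · rw [indicator_of_notMem (fun h => hc h.1), indicator_of_notMem (fun h => hc (mem_Iic.1 h))]
      rw [this, integrable_indicator_iff measurableSet_Iic]
      exact integrableOn_exp_Iic m
    · have : (fun c : ℝ => {q : ℝ × ℝ | q.2 ≤ q.1 ∧ q.1 ≤ a}.indicator (fun q => rexp q.2) (m, c)) =
          fun _ => 0 := by
        funext c
        rw [indicator_of_notMem (fun h => hm h.2)]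
      rw [this]
      exact integrable_zero _ _ _
  · have key : (fun m : ℝ => ∫ c, ‖{q : ℝ × ℝ | q.2 ≤ q.1 ∧ q.1 ≤ a}.indicator (fun q => rexp q.2) (m, c)‖) =
        (Iic a).indicator rexp := by
      funext m
      by_cases hm : m ≤ a
      · rw [indicator_of_mem (mem_Iic.2 hm)]
        have : (fun c : ℝ => ‖{q : ℝ × ℝ | q.2 ≤ q.1 ∧ q.1 ≤ a}.indicator (fun q => rexp q.2) (m, c)‖) =
            (Iic m).indicator rexp := by
          funext c
          by_cases hc : c ≤ m
          · rw [indicator_of_mem (show (m, c) ∈ {q : ℝ × ℝ | q.2 ≤ q.1 ∧ q.1 ≤ a} from ⟨hc, hm⟩),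
              indicator_of_mem (mem_Iic.2 hc), Real.norm_eq_abs, abs_of_pos (Real.exp_pos c)]
          · rw [indicator_of_notMem (fun h => hc h.1), indicator_of_notMem (fun h => hc (mem_Iic.1 h)),
              norm_zero]
        rw [this, integral_indicator measurableSet_Iic, integral_exp_Iic]
      · rw [indicator_of_notMem (fun h => hm (mem_Iic.1 h))]
        have : (fun c : ℝ => ‖{q : ℝ × ℝ | q.2 ≤ q.1 ∧ q.1 ≤ a}.indicator (fun q => rexp q.2) (m, c)‖) =
            fun _ => 0 := by
          funext c
          rw [indicator_of_notMem (fun h => hm h.2), norm_zero]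
        rw [this, integral_zero]
    rw [key, integrable_indicator_iff measurableSet_Iic]
    exact integrableOn_exp_Iic a

/-- **Fubini licence on `ℝ² × ℝ²`.**  For continuous `g` vanishing off `[−a, a]` the four-variable
integrand `Θ((m,c),(u,u')) = 1_{m ≤ a} 1_{c ≤ m} 1_{¬(u ≥ −m ∧ u' ≥ −m)} · G_c(u)·conj(G_c(u'))`,
`G_c(u) = g(u) e^{(u+c)/2} cos(2π e^{u+c})` (`= g u * cosTailKernel (u + c)`), is integrable: it is
dominated by `M² e^a · (1_{c ≤ m ≤ a} e^c) · 1_{[−a,a]²}(u, u')` with `M = sup ‖g‖`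
(`integrable_indicator_wedge_exp`). [folklore] -/
private theorem integrable_deltaSquare_kernel4 {g : ℝ → ℂ} (hg : Continuous g) {a : ℝ}
    (hsupp : ∀ u, a < |u| → g u = 0) :
    Integrable (fun x : (ℝ × ℝ) × (ℝ × ℝ) =>
      {x : (ℝ × ℝ) × (ℝ × ℝ) | x.1.1 ≤ a ∧ x.1.2 ≤ x.1.1 ∧ ¬ (-x.1.1 ≤ x.2.1 ∧ -x.1.1 ≤ x.2.2)}.indicator
        (fun x => g x.2.1 * ((rexp ((x.2.1 + x.1.2) / 2) * Real.cos (2 * π * rexp (x.2.1 + x.1.2)) : ℝ) : ℂ) *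
          conj (g x.2.2 * ((rexp ((x.2.2 + x.1.2) / 2) * Real.cos (2 * π * rexp (x.2.2 + x.1.2)) : ℝ) : ℂ))) x)
      ((volume.prod volume).prod (volume.prod volume)) := by
  -- compact support ⇒ bounded
  have hcs : HasCompactSupport g := by
    refine HasCompactSupport.intro (isCompact_Icc : IsCompact (Icc (-|a|) (|a|))) fun u hu => ?_
    refine hsupp u ?_
    simp only [mem_Icc, not_and_or, not_le] at hu
    rcases hu with h | h
    · have hu0 : u < 0 := by linarith [abs_nonneg a]
      have : |a| < |u| := by rw [abs_of_neg hu0]; linarith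
      exact lt_of_le_of_lt (le_abs_self a) this
    · exact lt_of_le_of_lt (le_abs_self a) (lt_of_lt_of_le h (le_abs_self u))
  obtain ⟨M, hM⟩ := hg.bounded_above_of_compact_support hcs
  have hM0 : 0 ≤ M := le_trans (norm_nonneg _) (hM 0)
  have hga : ∀ v, g v ≠ 0 → |v| ≤ a := fun v hv => by
    by_contra h
    exact hv (hsupp v (not_le.1 h))
  -- the set `T` and the smooth part `F`
  set T : Set ((ℝ × ℝ) × (ℝ × ℝ)) :=
    {x | x.1.1 ≤ a ∧ x.1.2 ≤ x.1.1 ∧ ¬ (-x.1.1 ≤ x.2.1 ∧ -x.1.1 ≤ x.2.2)} with hTdef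
  have hT : MeasurableSet T := by
    refine (measurableSet_le (measurable_fst.comp measurable_fst) measurable_const).inter
      ((measurableSet_le (measurable_snd.comp measurable_fst) (measurable_fst.comp measurable_fst)).inter ?_)
    refine (MeasurableSet.inter ?_ ?_).compl
    · exact measurableSet_le ((measurable_fst.comp measurable_fst).neg) (measurable_fst.comp measurable_snd)
    · exact measurableSet_le ((measurable_fst.comp measurable_fst).neg) (measurable_snd.comp measurable_snd)
  set F : (ℝ × ℝ) × (ℝ × ℝ) → ℂ := fun x =>
    g x.2.1 * ((rexp ((x.2.1 + x.1.2) / 2) * Real.cos (2 * π * rexp (x.2.1 + x.1.2)) : ℝ) : ℂ) *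
      conj (g x.2.2 * ((rexp ((x.2.2 + x.1.2) / 2) * Real.cos (2 * π * rexp (x.2.2 + x.1.2)) : ℝ) : ℂ))
    with hFdef
  have hFc : Continuous F := by
    have h1 : Continuous fun x : (ℝ × ℝ) × (ℝ × ℝ) => x.2.1 + x.1.2 := by fun_prop
    have h2 : Continuous fun x : (ℝ × ℝ) × (ℝ × ℝ) => x.2.2 + x.1.2 := by fun_prop
    refine ((hg.comp (continuous_fst.comp continuous_snd)).mul
      (continuous_ofReal.comp (by fun_prop))).mul
      (continuous_conj.comp ((hg.comp (continuous_snd.comp continuous_snd)).mul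
        (continuous_ofReal.comp (by fun_prop))))
  have hmeas : AEStronglyMeasurable (T.indicator F) ((volume.prod volume).prod (volume.prod volume)) :=
    (hFc.measurable.indicator hT).aestronglyMeasurable
  -- the dominating function
  set I₂ : ℝ × ℝ → ℝ := (Icc (-a) a ×ˢ Icc (-a) a).indicator fun _ => (1 : ℝ) with hI₂def
  have hI₂ : Integrable I₂ (volume.prod volume) := by
    rw [hI₂def, integrable_indicator_iff (measurableSet_Icc.prod measurableSet_Icc)]
    refine integrableOn_const ?_
    rw [Measure.prod_prod]
    exact ENNReal.mul_ne_top measure_Icc_lt_top.ne measure_Icc_lt_top.ne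
  have hH : Integrable (fun x : (ℝ × ℝ) × (ℝ × ℝ) => M ^ 2 * rexp a *
      ({q : ℝ × ℝ | q.2 ≤ q.1 ∧ q.1 ≤ a}.indicator (fun q => rexp q.2) x.1 * I₂ x.2))
      ((volume.prod volume).prod (volume.prod volume)) :=
    ((integrable_indicator_wedge_exp a).mul_prod hI₂).const_mul _
  refine hH.mono' hmeas (Filter.Eventually.of_forall fun x => ?_)
  rcases x with ⟨⟨m, c⟩, ⟨u, u'⟩⟩
  have h1 : 0 ≤ {q : ℝ × ℝ | q.2 ≤ q.1 ∧ q.1 ≤ a}.indicator (fun q => rexp q.2) (m, c) :=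
    indicator_nonneg (fun q _ => (Real.exp_pos _).le) _
  have h2 : 0 ≤ I₂ (u, u') := by rw [hI₂def]; exact indicator_nonneg (fun _ _ => zero_le_one) _
  have hH0 : 0 ≤ M ^ 2 * rexp a *
      ({q : ℝ × ℝ | q.2 ≤ q.1 ∧ q.1 ≤ a}.indicator (fun q => rexp q.2) (m, c) * I₂ (u, u')) :=
    mul_nonneg (mul_nonneg (pow_nonneg hM0 2) (Real.exp_pos a).le) (mul_nonneg h1 h2)
  by_cases hx : ((m, c), (u, u')) ∈ T
  · rw [indicator_of_mem hx]
    simp only [hTdef, mem_setOf_eq] at hx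
    obtain ⟨hma, hcm, hmin⟩ := hx
    by_cases hu : g u = 0
    · simp only [hFdef, hu, zero_mul, norm_zero]; exact hH0
    by_cases hu' : g u' = 0
    · simp only [hFdef, hu', zero_mul, map_zero, mul_zero, norm_zero]; exact hH0
    have hua : |u| ≤ a := hga u hu
    have hua' : |u'| ≤ a := hga u' hu'
    have hbox : (u, u') ∈ Icc (-a) a ×ˢ Icc (-a) a := ⟨abs_le.1 hua, abs_le.1 hua'⟩
    have hwedge : (m, c) ∈ {q : ℝ × ℝ | q.2 ≤ q.1 ∧ q.1 ≤ a} := ⟨hcm, hma⟩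
    rw [hI₂def, indicator_of_mem hbox, indicator_of_mem hwedge, mul_one]
    simp only [hFdef, norm_mul, Complex.norm_conj, Complex.norm_real, Real.norm_eq_abs,
      abs_of_pos (Real.exp_pos _)]
    have hc1 : |Real.cos (2 * π * rexp (u + c))| ≤ 1 := Real.abs_cos_le_one _
    have hc2 : |Real.cos (2 * π * rexp (u' + c))| ≤ 1 := Real.abs_cos_le_one _
    have he1 : rexp ((u + c) / 2) ≤ rexp ((a + c) / 2) :=
      Real.exp_le_exp.2 (by linarith [le_abs_self u])
    have he2 : rexp ((u' + c) / 2) ≤ rexp ((a + c) / 2) :=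
      Real.exp_le_exp.2 (by linarith [le_abs_self u'])
    have hee : rexp ((a + c) / 2) * rexp ((a + c) / 2) = rexp a * rexp c := by
      rw [← Real.exp_add, ← Real.exp_add]; ring_nf
    calc ‖g u‖ * (rexp ((u + c) / 2) * |Real.cos (2 * π * rexp (u + c))|) *
          (‖g u'‖ * (rexp ((u' + c) / 2) * |Real.cos (2 * π * rexp (u' + c))|))
        ≤ M * (rexp ((a + c) / 2) * 1) * (M * (rexp ((a + c) / 2) * 1)) := by
          gcongr
          · exact hM u
          · exact hM u'
      _ = M ^ 2 * rexp a * rexp c := by rw [mul_one, mul_mul_mul_comm, hee]; ring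
  · rw [indicator_of_notMem hx, norm_zero]
    exact hH0

/-- **The `(m, c)`-integral of `Θ` at a fixed `(u, u')`** (notation of `integrable_deltaSquare_kernel4`):
whenever the section `q ↦ Θ(q, (u,u'))` is integrable (which holds for a.e. `(u,u')`),
`4 ∫_{ℝ²} Θ(q, (u,u')) dq = g(u)·conj(g(u'))·δ(e^{u−u'})`.  Indeed for `g(u) g(u') ≠ 0` one has
`|u|, |u'| ≤ a`, the constraint `m ≤ a` is implied by `m < −min(u,u')`, and the section is
`g(u) conj(g(u')) e^{(u+u')/2}` times `1_{m < −min(u,u')} 1_{c ≤ m} e^c cos(2πe^{u+c}) cos(2πe^{u'+c})`, so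
this is `four_mul_exp_mul_kernel_eq_traceRemainder`.
[cite: ConnesConsani2021, §2 Prop. 2.2 (i) (= arXiv Prop. 10 (i)) p. 10 (chunk p0010:L15–L18)] -/
theorem four_mul_integral_deltaSquare_kernel4_eq {g : ℝ → ℂ} {a : ℝ}
    (hsupp : ∀ u, a < |u| → g u = 0) (u u' : ℝ)
    (hint : Integrable (fun q : ℝ × ℝ =>
      {x : (ℝ × ℝ) × (ℝ × ℝ) | x.1.1 ≤ a ∧ x.1.2 ≤ x.1.1 ∧ ¬ (-x.1.1 ≤ x.2.1 ∧ -x.1.1 ≤ x.2.2)}.indicator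
        (fun x => g x.2.1 * ((rexp ((x.2.1 + x.1.2) / 2) * Real.cos (2 * π * rexp (x.2.1 + x.1.2)) : ℝ) : ℂ) *
          conj (g x.2.2 * ((rexp ((x.2.2 + x.1.2) / 2) * Real.cos (2 * π * rexp (x.2.2 + x.1.2)) : ℝ) : ℂ)))
        (q, (u, u'))) (volume.prod volume)) :
    4 * ∫ q : ℝ × ℝ,
      {x : (ℝ × ℝ) × (ℝ × ℝ) | x.1.1 ≤ a ∧ x.1.2 ≤ x.1.1 ∧ ¬ (-x.1.1 ≤ x.2.1 ∧ -x.1.1 ≤ x.2.2)}.indicator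
        (fun x => g x.2.1 * ((rexp ((x.2.1 + x.1.2) / 2) * Real.cos (2 * π * rexp (x.2.1 + x.1.2)) : ℝ) : ℂ) *
          conj (g x.2.2 * ((rexp ((x.2.2 + x.1.2) / 2) * Real.cos (2 * π * rexp (x.2.2 + x.1.2)) : ℝ) : ℂ)))
        (q, (u, u')) ∂(volume.prod volume) =
      g u * conj (g u') * (traceRemainder (rexp (u - u')) : ℂ) := by
  set T : Set ((ℝ × ℝ) × (ℝ × ℝ)) :=
    {x | x.1.1 ≤ a ∧ x.1.2 ≤ x.1.1 ∧ ¬ (-x.1.1 ≤ x.2.1 ∧ -x.1.1 ≤ x.2.2)} with hTdef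
  set F : (ℝ × ℝ) × (ℝ × ℝ) → ℂ := fun x =>
    g x.2.1 * ((rexp ((x.2.1 + x.1.2) / 2) * Real.cos (2 * π * rexp (x.2.1 + x.1.2)) : ℝ) : ℂ) *
      conj (g x.2.2 * ((rexp ((x.2.2 + x.1.2) / 2) * Real.cos (2 * π * rexp (x.2.2 + x.1.2)) : ℝ) : ℂ))
    with hFdef
  have hga : ∀ v, g v ≠ 0 → |v| ≤ a := fun v hv => by
    by_contra h
    exact hv (hsupp v (not_le.1 h))
  -- trivial cases
  by_cases hu : g u = 0
  · have h0 : ∀ q : ℝ × ℝ, T.indicator F (q, (u, u')) = 0 := fun q => by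
      by_cases hq : (q, (u, u')) ∈ T
      · rw [indicator_of_mem hq]; simp [hFdef, hu]
      · rw [indicator_of_notMem hq]
    simp_rw [h0, integral_zero, mul_zero, hu, zero_mul]
  by_cases hu' : g u' = 0
  · have h0 : ∀ q : ℝ × ℝ, T.indicator F (q, (u, u')) = 0 := fun q => by
      by_cases hq : (q, (u, u')) ∈ T
      · rw [indicator_of_mem hq]; simp [hFdef, hu']
      · rw [indicator_of_notMem hq]
    simp_rw [h0, integral_zero, mul_zero, hu', map_zero, mul_zero, zero_mul]
  have hua : |u| ≤ a := hga u hu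
  have hua' : |u'| ≤ a := hga u' hu'
  -- the constant and the real kernel
  set Cst : ℂ := g u * conj (g u') * (rexp ((u + u') / 2) : ℂ) with hCst
  set k : ℝ → ℝ := fun c => rexp c * (Real.cos (2 * π * rexp (u + c)) * Real.cos (2 * π * rexp (u' + c)))
    with hk
  have hpt : ∀ m c : ℝ, T.indicator F ((m, c), (u, u')) =
      (Iio (-min u u')).indicator (fun m => (Iic m).indicator (fun c => Cst * (k c : ℂ)) c) m := by
    intro m c
    have hmem : ((m, c), (u, u')) ∈ T ↔ m < -min u u' ∧ c ≤ m := by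
      simp only [hTdef, mem_setOf_eq]
      constructor
      · rintro ⟨_, hcm, hneg⟩
        refine ⟨?_, hcm⟩
        by_contra hcon
        apply hneg
        have : -m ≤ min u u' := by linarith [not_lt.1 hcon]
        exact ⟨this.trans (min_le_left _ _), this.trans (min_le_right _ _)⟩
      · rintro ⟨hm, hcm⟩
        have hmin : -a ≤ min u u' := le_min (abs_le.1 hua).1 (abs_le.1 hua').1
        refine ⟨by linarith, hcm, ?_⟩
        rintro ⟨h1, h2⟩
        have : -m ≤ min u u' := le_min h1 h2
        linarith
    by_cases hq : ((m, c), (u, u')) ∈ T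
    · obtain ⟨hm, hcm⟩ := hmem.1 hq
      rw [indicator_of_mem hq, indicator_of_mem (mem_Iio.2 hm), indicator_of_mem (mem_Iic.2 hcm)]
      simp only [hFdef, hCst, hk, map_mul, Complex.conj_ofReal]
      have hexp : rexp ((u + c) / 2) * rexp ((u' + c) / 2) = rexp ((u + u') / 2) * rexp c := by
        rw [← Real.exp_add, ← Real.exp_add]; ring_nf
      have key : ((rexp ((u + c) / 2) * Real.cos (2 * π * rexp (u + c)) : ℝ) : ℂ) *
          ((rexp ((u' + c) / 2) * Real.cos (2 * π * rexp (u' + c)) : ℝ) : ℂ) =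
          ((rexp ((u + u') / 2) : ℝ) : ℂ) *
            ((rexp c * (Real.cos (2 * π * rexp (u + c)) * Real.cos (2 * π * rexp (u' + c))) : ℝ) : ℂ) := by
        rw [← Complex.ofReal_mul, ← Complex.ofReal_mul]
        congr 1
        calc rexp ((u + c) / 2) * Real.cos (2 * π * rexp (u + c)) *
              (rexp ((u' + c) / 2) * Real.cos (2 * π * rexp (u' + c)))
            = (rexp ((u + c) / 2) * rexp ((u' + c) / 2)) *
                (Real.cos (2 * π * rexp (u + c)) * Real.cos (2 * π * rexp (u' + c))) := by ring
          _ = (rexp ((u + u') / 2) * rexp c) *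
                (Real.cos (2 * π * rexp (u + c)) * Real.cos (2 * π * rexp (u' + c))) := by rw [hexp]
          _ = _ := by ring
      calc g u * ((rexp ((u + c) / 2) * Real.cos (2 * π * rexp (u + c)) : ℝ) : ℂ) *
            (conj (g u') * ((rexp ((u' + c) / 2) * Real.cos (2 * π * rexp (u' + c)) : ℝ) : ℂ))
          = g u * conj (g u') * (((rexp ((u + c) / 2) * Real.cos (2 * π * rexp (u + c)) : ℝ) : ℂ) *
              ((rexp ((u' + c) / 2) * Real.cos (2 * π * rexp (u' + c)) : ℝ) : ℂ)) := by ring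
        _ = _ := by rw [key]; ring
    · rw [indicator_of_notMem hq]
      by_cases hm : m < -min u u'
      · have hcm : ¬ c ≤ m := fun h => hq (hmem.2 ⟨hm, h⟩)
        rw [indicator_of_mem (mem_Iio.2 hm), indicator_of_notMem (fun h => hcm (mem_Iic.1 h))]
      · rw [indicator_of_notMem (fun h => hm (mem_Iio.1 h))]
  -- integrate
  rw [integral_prod _ hint]
  show (4 : ℂ) * ∫ m : ℝ, ∫ c : ℝ, T.indicator F ((m, c), (u, u')) = _
  have h2 : ∀ m : ℝ, (∫ c : ℝ, T.indicator F ((m, c), (u, u'))) =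
      (Iio (-min u u')).indicator (fun m => Cst * ((∫ c in Iic m, k c : ℝ) : ℂ)) m := by
    intro m
    simp_rw [hpt m]
    by_cases hm : m ∈ Iio (-min u u')
    · simp_rw [indicator_of_mem hm]
      rw [integral_indicator measurableSet_Iic, integral_const_mul, integral_complex_ofReal]
    · simp_rw [indicator_of_notMem hm]
      rw [integral_zero]
  simp_rw [h2]
  rw [integral_indicator measurableSet_Iio, integral_const_mul, integral_complex_ofReal]
  have hB := four_mul_exp_mul_kernel_eq_traceRemainder u u'
  rw [← hB, hCst]
  push_cast
  ring

/-! ## 5. The core identity -/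

/-- **Core identity (the additive primitive form of (L2)).**  For continuous `g` vanishing off `[−a, a]`
and `G_c(u) = g(u) e^{(u+c)/2} cos(2π e^{u+c})` (`= g u * cosTailKernel (u + c)`),
`4 ∫_{m ≤ a} ∫_{c ≤ m} ( (∫_ℝ G_c)·conj(∫_ℝ G_c) − (∫_{u ≥ −m} G_c)·conj(∫_{u ≥ −m} G_c) ) dc dm = D(g ⋆ g̃)`:
expand the squares (`mul_conj_integral_sub_mul_conj_setIntegral`, bracket `1 − 1_{u ≥ −m}1_{u' ≥ −m}`),
Fubini on `ℝ² × ℝ²` (`integrable_deltaSquare_kernel4`), evaluate the `(m,c)`-integral for a.e. `(u,u')`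
(`four_mul_integral_deltaSquare_kernel4_eq`: the square-`Δ` kernel and Prop. 2.2 (i)), and assemble the
outer integral (`integral_integral_mul_conj_mul_traceRemainder_eq_remainderD`).
[cite: ConnesConsani2021, §2 Prop. 2.2 (i), (iii) (= arXiv Prop. 10) p. 10 (chunk p0010:L15–L23)] -/
theorem four_mul_integral_sub_normSq_eq_remainderD {g : ℝ → ℂ} (hg : Continuous g) {a : ℝ}
    (hsupp : ∀ u, a < |u| → g u = 0) :
    4 * ∫ m in Iic a, ∫ c in Iic m,
      ((∫ u, g u * ((rexp ((u + c) / 2) * Real.cos (2 * π * rexp (u + c)) : ℝ) : ℂ)) *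
          conj (∫ u, g u * ((rexp ((u + c) / 2) * Real.cos (2 * π * rexp (u + c)) : ℝ) : ℂ)) -
        (∫ u in Ici (-m), g u * ((rexp ((u + c) / 2) * Real.cos (2 * π * rexp (u + c)) : ℝ) : ℂ)) *
          conj (∫ u in Ici (-m), g u * ((rexp ((u + c) / 2) * Real.cos (2 * π * rexp (u + c)) : ℝ) : ℂ))) =
      remainderD (weilConv g (weilReflect g)) := by
  set T : Set ((ℝ × ℝ) × (ℝ × ℝ)) :=
    {x | x.1.1 ≤ a ∧ x.1.2 ≤ x.1.1 ∧ ¬ (-x.1.1 ≤ x.2.1 ∧ -x.1.1 ≤ x.2.2)} with hTdef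
  set F : (ℝ × ℝ) × (ℝ × ℝ) → ℂ := fun x =>
    g x.2.1 * ((rexp ((x.2.1 + x.1.2) / 2) * Real.cos (2 * π * rexp (x.2.1 + x.1.2)) : ℝ) : ℂ) *
      conj (g x.2.2 * ((rexp ((x.2.2 + x.1.2) / 2) * Real.cos (2 * π * rexp (x.2.2 + x.1.2)) : ℝ) : ℂ))
    with hFdef
  have hΘ : Integrable (T.indicator F) ((volume.prod volume).prod (volume.prod volume)) :=
    integrable_deltaSquare_kernel4 hg hsupp
  -- compact support of `g`
  have hcs : HasCompactSupport g := by
    refine HasCompactSupport.intro (isCompact_Icc : IsCompact (Icc (-|a|) (|a|))) fun u hu => ?_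
    refine hsupp u ?_
    simp only [mem_Icc, not_and_or, not_le] at hu
    rcases hu with h | h
    · have hu0 : u < 0 := by linarith [abs_nonneg a]
      have : |a| < |u| := by rw [abs_of_neg hu0]; linarith
      exact lt_of_le_of_lt (le_abs_self a) this
    · exact lt_of_le_of_lt (le_abs_self a) (lt_of_lt_of_le h (le_abs_self u))
  -- the column `G_c` is integrable
  have hG : ∀ c : ℝ, Integrable (fun u : ℝ =>
      g u * ((rexp ((u + c) / 2) * Real.cos (2 * π * rexp (u + c)) : ℝ) : ℂ)) := by
    intro c
    refine Continuous.integrable_of_hasCompactSupport (hg.mul (continuous_ofReal.comp (by fun_prop))) ?_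
    exact hcs.mul_right
  -- Step 1–2: the `(m,c)`-integrand is the `p`-integral of `Θ`
  have h12 : (∫ m in Iic a, ∫ c in Iic m,
      ((∫ u, g u * ((rexp ((u + c) / 2) * Real.cos (2 * π * rexp (u + c)) : ℝ) : ℂ)) *
          conj (∫ u, g u * ((rexp ((u + c) / 2) * Real.cos (2 * π * rexp (u + c)) : ℝ) : ℂ)) -
        (∫ u in Ici (-m), g u * ((rexp ((u + c) / 2) * Real.cos (2 * π * rexp (u + c)) : ℝ) : ℂ)) *
          conj (∫ u in Ici (-m), g u * ((rexp ((u + c) / 2) * Real.cos (2 * π * rexp (u + c)) : ℝ) : ℂ)))) =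
      ∫ m, ∫ c, ∫ p : ℝ × ℝ, T.indicator F ((m, c), p) ∂(volume.prod volume) := by
    rw [← integral_indicator measurableSet_Iic]
    refine integral_congr_ae (Filter.Eventually.of_forall fun m => ?_)
    by_cases hm : m ≤ a
    · rw [indicator_of_mem (mem_Iic.2 hm), ← integral_indicator measurableSet_Iic]
      refine integral_congr_ae (Filter.Eventually.of_forall fun c => ?_)
      by_cases hc : c ≤ m
      · rw [indicator_of_mem (mem_Iic.2 hc),
          mul_conj_integral_sub_mul_conj_setIntegral (hG c) measurableSet_Ici]
        refine integral_congr_ae (Filter.Eventually.of_forall fun p => ?_)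
        show _ = T.indicator F ((m, c), p)
        have hmem : ((m, c), p) ∈ T ↔ p ∈ (Ici (-m) ×ˢ Ici (-m))ᶜ := by
          simp only [hTdef, mem_setOf_eq, mem_compl_iff, mem_prod, mem_Ici]
          exact ⟨fun h => h.2.2, fun h => ⟨hm, hc, h⟩⟩
        by_cases hp : p ∈ (Ici (-m) ×ˢ Ici (-m))ᶜ
        · rw [indicator_of_mem hp, indicator_of_mem (hmem.2 hp)]
        · rw [indicator_of_notMem hp, indicator_of_notMem (fun h => hp (hmem.1 h))]
      · rw [indicator_of_notMem (fun h => hc (mem_Iic.1 h))]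
        have h0 : ∀ p : ℝ × ℝ, T.indicator F ((m, c), p) = 0 := fun p =>
          indicator_of_notMem (fun h => hc h.2.1) _
        simp_rw [h0, integral_zero]
    · rw [indicator_of_notMem (fun h => hm (mem_Iic.1 h))]
      have h0 : ∀ (c : ℝ) (p : ℝ × ℝ), T.indicator F ((m, c), p) = 0 := fun c p =>
        indicator_of_notMem (fun h => hm h.1) _
      simp_rw [h0, integral_zero]
  rw [h12]
  -- Step 3: `(m,c)` as one variable
  have h3 : (∫ m, ∫ c, ∫ p : ℝ × ℝ, T.indicator F ((m, c), p) ∂(volume.prod volume)) =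
      ∫ q : ℝ × ℝ, ∫ p : ℝ × ℝ, T.indicator F (q, p) ∂(volume.prod volume) ∂(volume.prod volume) :=
    (integral_prod (fun q : ℝ × ℝ => ∫ p : ℝ × ℝ, T.indicator F (q, p) ∂(volume.prod volume))
      hΘ.integral_prod_left).symm
  rw [h3]
  -- Step 4: swap
  have h4 : (∫ q : ℝ × ℝ, ∫ p : ℝ × ℝ, T.indicator F (q, p) ∂(volume.prod volume) ∂(volume.prod volume)) =
      ∫ p : ℝ × ℝ, ∫ q : ℝ × ℝ, T.indicator F (q, p) ∂(volume.prod volume) ∂(volume.prod volume) :=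
    integral_integral_swap (f := fun q p => T.indicator F (q, p)) hΘ
  rw [h4, ← integral_const_mul]
  -- Step 5: evaluate the inner integral a.e. and conclude with the outer assembly
  have h5 : (fun p : ℝ × ℝ => (4 : ℂ) * ∫ q : ℝ × ℝ, T.indicator F (q, p) ∂(volume.prod volume)) =ᵐ[volume.prod volume]
      fun p => g p.1 * conj (g p.2) * (traceRemainder (rexp (p.1 - p.2)) : ℂ) := by
    filter_upwards [hΘ.prod_left_ae] with p hp
    exact four_mul_integral_deltaSquare_kernel4_eq hsupp p.1 p.2 hp
  rw [integral_congr_ae h5]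
  -- `p ↦ g(p.1) conj g(p.2) δ(e^{p.1 - p.2})` is continuous with compact support
  have hδ : Continuous fun t : ℝ => (traceRemainder (rexp t) : ℂ) :=
    continuous_ofReal.comp continuous_traceRemainder_exp
  have hcont2 : Continuous fun p : ℝ × ℝ => g p.1 * conj (g p.2) * (traceRemainder (rexp (p.1 - p.2)) : ℂ) :=
    ((hg.comp continuous_fst).mul (continuous_conj.comp (hg.comp continuous_snd))).mul
      (hδ.comp (continuous_fst.sub continuous_snd))
  have hga' : ∀ v, g v ≠ 0 → v ∈ Icc (-|a|) (|a|) := fun v hv => by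
    have h : |v| ≤ a := by
      by_contra h
      exact hv (hsupp v (not_le.1 h))
    have h' : |v| ≤ |a| := h.trans (le_abs_self a)
    exact ⟨(abs_le.1 h').1, (abs_le.1 h').2⟩
  have hsupp2 : HasCompactSupport fun p : ℝ × ℝ =>
      g p.1 * conj (g p.2) * (traceRemainder (rexp (p.1 - p.2)) : ℂ) := by
    refine HasCompactSupport.intro ((isCompact_Icc : IsCompact (Icc (-|a|) (|a|))).prod
      (isCompact_Icc : IsCompact (Icc (-|a|) (|a|)))) fun p hp => ?_
    by_cases h1 : g p.1 = 0
    · rw [h1, zero_mul, zero_mul]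
    by_cases h2 : g p.2 = 0
    · rw [h2, map_zero, mul_zero, zero_mul]
    exact absurd (mem_prod.2 ⟨hga' _ h1, hga' _ h2⟩) hp
  have hint2 : Integrable (fun p : ℝ × ℝ => g p.1 * conj (g p.2) * (traceRemainder (rexp (p.1 - p.2)) : ℂ))
      (volume.prod volume) :=
    hcont2.integrable_of_hasCompactSupport hsupp2
  rw [integral_prod _ hint2]
  exact integral_integral_mul_conj_mul_traceRemainder_eq_remainderD hg hsupp

/-! ## 6. (L2) in the `cosTail` vocabulary -/

/-- A measurable `h` on `ℝ²` with `|h(m, c)| ≤ C e^c` is integrable on the wedge `{c ≤ m ≤ a}`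
(dominated by `C·1_{c ≤ m ≤ a} e^c`, `integrable_indicator_wedge_exp`). [folklore] -/
private theorem integrable_wedge_indicator_of_norm_sq_le {h : ℝ × ℝ → ℝ} (hmeas : Measurable h) {C a : ℝ}
    (hle : ∀ q : ℝ × ℝ, |h q| ≤ C * rexp q.2) :
    Integrable ({q : ℝ × ℝ | q.2 ≤ q.1 ∧ q.1 ≤ a}.indicator h) (volume.prod volume) := by
  have hW : MeasurableSet {q : ℝ × ℝ | q.2 ≤ q.1 ∧ q.1 ≤ a} :=
    (measurableSet_le measurable_snd measurable_fst).inter (measurableSet_le measurable_fst measurable_const)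
  refine ((integrable_indicator_wedge_exp a).const_mul C).mono' ((hmeas.indicator hW).aestronglyMeasurable)
    (Filter.Eventually.of_forall fun q => ?_)
  by_cases hq : q ∈ {q : ℝ × ℝ | q.2 ≤ q.1 ∧ q.1 ≤ a}
  · rw [indicator_of_mem hq, indicator_of_mem hq, Real.norm_eq_abs]
    exact hle q
  · rw [indicator_of_notMem hq, indicator_of_notMem hq, norm_zero, mul_zero]

end CosTailDeltaSquare

open CosTailDeltaSquare in
/-- **(L2) — the square-`Δ` half of the cosine-tail energy identity (T2) behind `CC2021_prop_2_2_iii`.**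
For a Weil test function `g` (`IsWeilTest g`: smooth with compact support) with `tsupport g ⊆ [−a, a]`,

`4·(∫_{c ≤ a} (a − c)·‖cosTailFull g c‖² dc) − 4·(∫_{m ∈ [−a,a]} ∫_{c ≤ m} ‖cosTail g (c − m) c‖² dc dm) = Re D(g ⋆ g̃)`,

where `D = remainderD` is the functional `k ↦ ∫ k(t) δ(e^t) dt` of the trace remainder `δ = traceRemainder`
(Def. 2.1, defined in the tree by the closed form (25) and the symmetry (ii)) and
`g ⋆ g̃ = weilConv g (weilReflect g)`.  Both integrals are parenthesized on purpose: Mathlib's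
`∫ x in s, ·` binder (body at precedence 60) would otherwise swallow the following `− 4·∫ …`.

PROOF (the cell's route memo cc/drafts/t1g2-T2-ROUTE.md §4, carried out in ADDITIVE variables `c = log w`,
`m` = cut-off index, so that no half-line cosine transform has to be defined): write both transforms as
`u`-integrals of `G_c(u) = g(u)·cosTailKernel(u + c)` (`cosTailFull_eq_integral_comp_add`,
`cosTail_eq_integral_comp_add`); trade the weight `(a − c)` for `∫ 1_{c ≤ m ≤ a} dm` and the range
`m ∈ [−a, a]` for `m ≤ a` (`cosTail_eq_zero`: the tail vanishes for `m < −a`) by Fubini on the wedge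
`{c ≤ m ≤ a}` (dominators from `norm_cosTailFull_le`, `norm_cosTail_le`); then apply the core identity
`CosTailDeltaSquare.four_mul_integral_sub_normSq_eq_remainderD` — expansion of the squares, Fubini on
`ℝ² × ℝ²`, the square-`Δ` kernel (`CosTailDeltaSquare.kernel_eq_deltaSquareIntegral`), Prop. 2.2 (i)
`δ(ρ) = 4ρ^{1/2}Δ(ρ)` (DISCHARGED: `CC2021_prop_2_2_i_holds`) with (ii) `δ(ρ⁻¹) = δ(ρ)` (`traceRemainder_inv`),
and the substitution `u' = u − t` (`weilConv_apply`) — and take real parts.  Consumers: the frame /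
assembly leaf `CosineTailEnergy.lean` (hypothesis `H2`, verbatim) and `CC2021_prop_2_2_iii_of_cosTail_energy`
(`CutoffScalingKernelEnergy.lean`).
[cite: ConnesConsani2021, §2 Prop. 2.2 (i)–(iii) (= arXiv Prop. 10) p. 10 (chunk p0010:L15–L23; proof of (i) L25–L49); §1 Lemma 1.4 (i) (= arXiv Lemma 7 (i)) eq. (16) p. 7] -/
theorem cosTail_deltaSquare {g : ℝ → ℂ} {a : ℝ} (hg : IsWeilTest g) (hga : tsupport g ⊆ Set.Icc (-a) a) :
    4 * (∫ c in Set.Iic a, (a - c) * ‖cosTailFull g c‖ ^ 2) -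
      4 * (∫ m in Set.Icc (-a) a, ∫ c in Set.Iic m, ‖cosTail g (c - m) c‖ ^ 2) =
      (remainderD (weilConv g (weilReflect g))).re := by
  have hgc : Continuous g := hg.1.continuous
  have hcs : HasCompactSupport g := hg.2
  have hsupp : ∀ u, a < |u| → g u = 0 := fun u hu => by
    refine image_eq_zero_of_notMem_tsupport fun hmem => ?_
    have h := hga hmem
    exact absurd (abs_le.2 ⟨h.1, h.2⟩) (not_le.2 hu)
  -- the complex core identity, rewritten with `cosTail`/`cosTailFull`
  have core := four_mul_integral_sub_normSq_eq_remainderD hgc hsupp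
  have hfull : ∀ c : ℝ, (∫ u, g u * ((rexp ((u + c) / 2) * Real.cos (2 * π * rexp (u + c)) : ℝ) : ℂ)) =
      cosTailFull g c := fun c => (cosTailFull_eq_integral_comp_add g c).symm
  have htail : ∀ m c : ℝ, (∫ u in Ici (-m), g u * ((rexp ((u + c) / 2) * Real.cos (2 * π * rexp (u + c)) : ℝ) : ℂ)) =
      cosTail g (c - m) c := fun m c => by
    rw [cosTail_eq_integral_comp_add, sub_sub_cancel_left]; rfl
  simp_rw [hfull, htail, Complex.mul_conj', ← Complex.ofReal_pow, ← Complex.ofReal_sub,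
    integral_complex_ofReal] at core
  -- real form of the core identity
  have hre : 4 * ∫ m in Iic a, ∫ c in Iic m, (‖cosTailFull g c‖ ^ 2 - ‖cosTail g (c - m) c‖ ^ 2) =
      (remainderD (weilConv g (weilReflect g))).re := by
    rw [← core]
    simp only [Complex.mul_re, Complex.ofReal_re, Complex.ofReal_im, mul_zero, sub_zero]
    norm_num
  rw [← hre]
  -- the two wedge-cut densities on `ℝ²`
  set W : Set (ℝ × ℝ) := {q | q.2 ≤ q.1 ∧ q.1 ≤ a}
  have hW : MeasurableSet W :=
    (measurableSet_le measurable_snd measurable_fst).inter (measurableSet_le measurable_fst measurable_const)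
  set f₁ : ℝ × ℝ → ℝ := W.indicator fun q => ‖cosTailFull g q.2‖ ^ 2 with hf₁def
  set f₂ : ℝ × ℝ → ℝ := W.indicator fun q => ‖cosTail g (q.2 - q.1) q.2‖ ^ 2 with hf₂def
  set C : ℝ := rexp a * (∫ u, ‖g u‖) ^ 2 with hCdef
  have hbound_full : ∀ c : ℝ, ‖cosTailFull g c‖ ^ 2 ≤ C * rexp c := fun c => by
    have h := norm_cosTailFull_le hgc hcs hga c
    have h0 : 0 ≤ rexp ((c + a) / 2) * ∫ u, ‖g u‖ := by positivity
    calc ‖cosTailFull g c‖ ^ 2 ≤ (rexp ((c + a) / 2) * ∫ u, ‖g u‖) ^ 2 :=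
          pow_le_pow_left₀ (norm_nonneg _) h 2
      _ = C * rexp c := by
          rw [hCdef, mul_pow, ← Real.exp_nat_mul]
          rw [show ((2 : ℕ) : ℝ) * ((c + a) / 2) = a + c by push_cast; ring, Real.exp_add]; ring
  have hbound_tail : ∀ m c : ℝ, ‖cosTail g (c - m) c‖ ^ 2 ≤ C * rexp c := fun m c => by
    have h := norm_cosTail_le hgc hcs hga (c - m) c
    have h0 : 0 ≤ rexp ((c + a) / 2) * ∫ u, ‖g u‖ := by positivity
    calc ‖cosTail g (c - m) c‖ ^ 2 ≤ (rexp ((c + a) / 2) * ∫ u, ‖g u‖) ^ 2 :=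
          pow_le_pow_left₀ (norm_nonneg _) h 2
      _ = C * rexp c := by
          rw [hCdef, mul_pow, ← Real.exp_nat_mul]
          rw [show ((2 : ℕ) : ℝ) * ((c + a) / 2) = a + c by push_cast; ring, Real.exp_add]; ring
  have hf₁ : Integrable f₁ (volume.prod volume) := by
    refine integrable_wedge_indicator_of_norm_sq_le (C := C) ?_ (fun q => ?_)
    · exact ((continuous_cosTailFull hgc hcs).comp continuous_snd).norm.pow 2 |>.measurable
    · rw [abs_of_nonneg (by positivity)]; exact hbound_full q.2
  have hf₂ : Integrable f₂ (volume.prod volume) := by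
    refine integrable_wedge_indicator_of_norm_sq_le (C := C) ?_ (fun q => ?_)
    · have hc2 : Continuous fun q : ℝ × ℝ => cosTail g (q.2 - q.1) q.2 :=
        (continuous_cosTail hgc hcs).comp ((continuous_snd.sub continuous_fst).prodMk continuous_snd)
      exact (hc2.norm.pow 2).measurable
    · rw [abs_of_nonneg (by positivity)]; exact hbound_tail q.1 q.2
  -- (R1): the iterated set integral is `∫ (f₁ − f₂)`
  have hR1 : (∫ m in Iic a, ∫ c in Iic m, (‖cosTailFull g c‖ ^ 2 - ‖cosTail g (c - m) c‖ ^ 2)) =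
      ∫ q, (f₁ q - f₂ q) ∂(volume.prod volume) := by
    have hsub : Integrable (fun q : ℝ × ℝ => f₁ q - f₂ q) (volume.prod volume) := hf₁.sub hf₂
    rw [integral_prod _ hsub, ← integral_indicator measurableSet_Iic]
    refine integral_congr_ae (Filter.Eventually.of_forall fun m => ?_)
    show (Iic a).indicator (fun m => ∫ c in Iic m, (‖cosTailFull g c‖ ^ 2 - ‖cosTail g (c - m) c‖ ^ 2)) m =
      ∫ c, (f₁ (m, c) - f₂ (m, c))
    by_cases hm : m ≤ a
    · rw [indicator_of_mem (mem_Iic.2 hm), ← integral_indicator measurableSet_Iic]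
      refine integral_congr_ae (Filter.Eventually.of_forall fun c => ?_)
      show (Iic m).indicator (fun c => ‖cosTailFull g c‖ ^ 2 - ‖cosTail g (c - m) c‖ ^ 2) c =
        f₁ (m, c) - f₂ (m, c)
      by_cases hc : c ≤ m
      · have hq : (m, c) ∈ W := ⟨hc, hm⟩
        rw [indicator_of_mem (mem_Iic.2 hc)]
        simp only [hf₁def, hf₂def, indicator_of_mem hq]
      · have hq : (m, c) ∉ W := fun h => hc h.1
        rw [indicator_of_notMem (fun h => hc (mem_Iic.1 h))]
        simp only [hf₁def, hf₂def, indicator_of_notMem hq, sub_zero]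
    · rw [indicator_of_notMem (fun h => hm (mem_Iic.1 h))]
      have h0 : ∀ c : ℝ, f₁ (m, c) - f₂ (m, c) = 0 := fun c => by
        have hq : (m, c) ∉ W := fun h => hm h.2
        simp only [hf₁def, hf₂def, indicator_of_notMem hq, sub_zero]
      simp_rw [h0, integral_zero]
  -- (R2): `∫ f₁ = ∫_{c ≤ a} (a − c)‖cosTailFull g c‖²`
  have hR2 : (∫ q, f₁ q ∂(volume.prod volume)) = ∫ c in Iic a, (a - c) * ‖cosTailFull g c‖ ^ 2 := by
    rw [integral_prod_symm _ hf₁, ← integral_indicator measurableSet_Iic]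
    refine integral_congr_ae (Filter.Eventually.of_forall fun c => ?_)
    show (∫ m, f₁ (m, c)) = (Iic a).indicator (fun c => (a - c) * ‖cosTailFull g c‖ ^ 2) c
    by_cases hc : c ≤ a
    · rw [indicator_of_mem (mem_Iic.2 hc)]
      have h1 : (fun m : ℝ => f₁ (m, c)) = (Icc c a).indicator fun _ => ‖cosTailFull g c‖ ^ 2 := by
        funext m
        by_cases hm : m ∈ Icc c a
        · rw [indicator_of_mem hm]
          simp only [hf₁def, indicator_of_mem (show (m, c) ∈ W from ⟨hm.1, hm.2⟩)]
        · rw [indicator_of_notMem hm]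
          simp only [hf₁def, indicator_of_notMem (show (m, c) ∉ W from fun h => hm ⟨h.1, h.2⟩)]
      rw [h1, integral_indicator measurableSet_Icc, setIntegral_const, Real.volume_real_Icc_of_le hc,
        smul_eq_mul]
    · rw [indicator_of_notMem (fun h => hc (mem_Iic.1 h))]
      have h1 : ∀ m : ℝ, f₁ (m, c) = 0 := fun m => by
        simp only [hf₁def, indicator_of_notMem (show (m, c) ∉ W from fun h => hc (h.1.trans h.2))]
      simp_rw [h1, integral_zero]
  -- (R3): `∫ f₂ = ∫_{m ∈ [−a,a]} ∫_{c ≤ m} ‖cosTail g (c−m) c‖²`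
  have hR3 : (∫ q, f₂ q ∂(volume.prod volume)) =
      ∫ m in Icc (-a) a, ∫ c in Iic m, ‖cosTail g (c - m) c‖ ^ 2 := by
    rw [integral_prod _ hf₂, ← integral_indicator measurableSet_Icc]
    refine integral_congr_ae (Filter.Eventually.of_forall fun m => ?_)
    show (∫ c, f₂ (m, c)) = (Icc (-a) a).indicator (fun m => ∫ c in Iic m, ‖cosTail g (c - m) c‖ ^ 2) m
    by_cases hm : m ∈ Icc (-a) a
    · rw [indicator_of_mem hm, ← integral_indicator measurableSet_Iic]
      refine integral_congr_ae (Filter.Eventually.of_forall fun c => ?_)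
      show f₂ (m, c) = (Iic m).indicator (fun c => ‖cosTail g (c - m) c‖ ^ 2) c
      by_cases hc : c ≤ m
      · rw [indicator_of_mem (mem_Iic.2 hc)]
        simp only [hf₂def, indicator_of_mem (show (m, c) ∈ W from ⟨hc, hm.2⟩)]
      · rw [indicator_of_notMem (fun h => hc (mem_Iic.1 h))]
        simp only [hf₂def, indicator_of_notMem (show (m, c) ∉ W from fun h => hc h.1)]
    · rw [indicator_of_notMem hm]
      have h0 : ∀ c : ℝ, f₂ (m, c) = 0 := fun c => by
        by_cases hq : (m, c) ∈ W
        · -- then `m ≤ a`, so `m < -a`, and the tail vanishes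
          have hma : m < -a := by
            by_contra h
            exact hm ⟨not_lt.1 h, hq.2⟩
          simp only [hf₂def, indicator_of_mem hq]
          rw [cosTail_eq_zero hga (by linarith), norm_zero, zero_pow two_ne_zero]
        · simp only [hf₂def, indicator_of_notMem hq]
      simp_rw [h0, integral_zero]
  rw [← hR2, ← hR3, hR1, integral_sub hf₁ hf₂, mul_sub]

end Literature.NumberTheory.ConnesConsani2021
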